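import Literature.NumberTheory.EllipticCurves.BinaryQuarticGoodReductionSolubilityProofs
import Literature.NumberTheory.EllipticCurves.BinaryQuarticInvariantMapSubmersiveProofs
import Literature.NumberTheory.EllipticCurves.BinaryQuarticDiscriminantFirstOrderProofs
import HarnessLib

/-!
# Forms with prescribed invariants modulo prime powers:
# `#{f ∈ V(ℤ/pᵏℤ) : (I, J) ≡ (I₀, J₀)} = (p³ − p)·p^{3(k−1)} = #PGL₂(ℤ/pᵏℤ)` for `p ∤ 4I₀³ − J₀²`

`Proofs` companion (theorems only: no definitions, no named facts) of `BinaryQuarticForms.lean`,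
continuing `BinaryQuarticInvariantCountProofs.lean` (the case `k = 1`: `q³ − q` forms over `𝔽_q`)
with the Hensel lifting provided by `BinaryQuarticInvariantMapSubmersiveProofs.lean` (the invariant
map `(I, J)` is submersive off `Δ = 0`) and the first-order calculus of
`BinaryQuarticDiscriminantFirstOrderProofs.lean` (`I(f + tg) = I(f) + t·DI(f;g) + t²I(g)`, …).

Source and role. M. Bhargava, A. Shankar, *Binary quartic forms having bounded invariants, and the
boundedness of the average rank of elliptic curves*, Ann. of Math. (2) 181 (2015) 191–242. The
local masses of Prop. 5.12 of the held arXiv text `arXiv:1006.1002v2` (Props. 3.7–3.9 of the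
published version) rest on the `p`-adic change-of-measure formula for the invariant map: for sets
`S ⊂ V_{ℤ_p}` cut out by conditions on `(I, J)`,
`μ_p(S) = |1/27|_p · Vol(PGL₂(ℤ_p)) · ∫ Σ_{orbits} (1/#Stab) dI dJ`, `Vol(PGL₂(ℤ_p)) = 1 − p⁻²`. Over
the locus of good reduction (`p ∤ 4I³ − J²`, where `Σ_{orbits} 1/#Stab = 1`) this says that the
invariant map pushes the normalised Haar measure `μ_p` of `V_{ℤ_p}` forward to `(1 − p⁻²)·dI dJ`,
i.e. that **the residue class `{(I, J) ≡ (I₀, J₀) (mod pᵏ)}` has `μ_p`-measure `(1 − p⁻²)p^{−2k}`**.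
This file proves the equivalent count:

* `BinaryQuartic.natCard_invariants_zmod_primePow`: for a prime `p ≥ 5`, integers `I₀, J₀` with
  `p ∤ 4I₀³ − J₀²`, and `k ≥ 1`,
  **`#{f ∈ V(ℤ/pᵏℤ) : I(f) ≡ I₀, J(f) ≡ J₀} = (p³ − p)·p^{3(k−1)}`** (`= #PGL₂(ℤ/pᵏℤ)`).

## The argument (Hensel)

Write `ℤ/npℤ ∋ x = (x mod n) + n·(x div n)` (`§ Digits`; `n = pᵏ⁻¹·p…`, in general any `n` with
`p ∣ n`). A form modulo `np` is `ỹ + n·z̃` for the `val`-lifts of `y = f mod n ∈ V(ℤ/n)` and of its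
vector of high digits `z ∈ V(𝔽_p)` (`§ Forms`). Since `n² = 0` in `ℤ/np`,
`I(ỹ + n z̃) = I(ỹ) + n·DI(ỹ; z̃)` and `J(ỹ + n z̃) = J(ỹ) + n·DJ(ỹ; z̃)` exactly; if `y` is a solution
modulo `n` then `I(ỹ) − I₀ = n·w_I`, and `n·v = 0 ⇔ v ≡ 0 (mod p)`, so `ỹ + n z̃` is a solution modulo
`np` iff `z` solves the affine system `DI(ȳ; z) = −w̄_I`, `DJ(ȳ; z) = −w̄_J` over `𝔽_p`
(`combine_mem_iff`, `§ Fibre`). At `ȳ = y mod p` the discriminant is `≢ 0`, so a `2 × 2` minor of the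
Jacobian of `(I, J)` in the columns `a` and one of `b, c, d` is invertible
(`jacobianMinor_ne_zero_of_disc_ne_zero`) and the system has exactly `p³` solutions, two unknowns
being affine functions of the other three (`natCard_polar_fibre`, `§ Linear`). Hence
`#(solutions mod np) = p³ · #(solutions mod n)` (`natCard_invariants_mul`), and induction from
`#(solutions mod p) = p³ − p` (`natCard_invariants_eq`) gives the theorem.

## References

* M. Bhargava, A. Shankar, Ann. of Math. (2) 181 (2015) 191–242 = arXiv:1006.1002, Prop. 5.12 of
  the arXiv v2 text and its proof (Props. 3.7–3.9 of the published version).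
  [cite: BhargavaShankarAnnals2015, Prop. 5.12 (arXiv:1006.1002v2 numbering)]
-/

noncomputable section

open scoped Classical

namespace Literature.NumberTheory.EllipticCurves

namespace BinaryQuartic

/-! ## Digits: `ℤ/npℤ` versus `ℤ/nℤ × ℤ/pℤ` -/

section Digits

variable {n p : ℕ} [NeZero n] [NeZero p]

/-- The base-`n` digit decomposition of a residue modulo `np`: `x = (x mod n) + n·(x div n)`.
[folklore] -/
theorem digits_zmod_eq_mod_add_mul_div (x : ZMod (n * p)) :
    x = ((x.val % n : ℕ) : ZMod (n * p)) + (n : ZMod (n * p)) * ((x.val / n : ℕ) : ZMod (n * p)) := by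
  conv_lhs => rw [← ZMod.natCast_zmod_val x, ← Nat.mod_add_div x.val n]
  push_cast
  ring

/-- The high digit is `< p`. [folklore] -/
theorem digits_val_div_lt (x : ZMod (n * p)) : x.val / n < p := by
  rw [Nat.div_lt_iff_lt_mul (Nat.pos_of_ne_zero (NeZero.ne n))]
  calc x.val < n * p := ZMod.val_lt x
    _ = p * n := Nat.mul_comm n p

/-- `val` of the combined residue `y + n·z`. [folklore] -/
theorem digits_val_combine (y : ZMod n) (z : ZMod p) :
    ((y.val + n * z.val : ℕ) : ZMod (n * p)).val = y.val + n * z.val := by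
  apply ZMod.val_cast_of_lt
  have hy := ZMod.val_lt y
  have hz := ZMod.val_lt z
  calc y.val + n * z.val < n + n * z.val := by omega
    _ = n * (z.val + 1) := by ring
    _ ≤ n * p := Nat.mul_le_mul_left _ hz

omit [NeZero p] in
/-- Reducing the combined residue modulo `n` recovers `y`. [folklore] -/
theorem digits_cast_combine (y : ZMod n) (z : ZMod p) :
    (ZMod.castHom (dvd_mul_right n p) (ZMod n)) ((y.val + n * z.val : ℕ) : ZMod (n * p)) = y := by
  rw [map_natCast]
  push_cast
  rw [ZMod.natCast_self, zero_mul, add_zero, ZMod.natCast_zmod_val]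

/-- The high digit of the combined residue is `z`. [folklore] -/
theorem digits_div_combine (y : ZMod n) (z : ZMod p) :
    (((y.val + n * z.val : ℕ) : ZMod (n * p)).val / n : ℕ) = z.val := by
  rw [digits_val_combine, Nat.add_mul_div_left _ _ (Nat.pos_of_ne_zero (NeZero.ne n)),
    Nat.div_eq_of_lt (ZMod.val_lt y), zero_add]

/-- The low digit as `castHom`: `x mod n = castHom x`. [folklore] -/
theorem digits_cast_eq_mod (x : ZMod (n * p)) :
    (ZMod.castHom (dvd_mul_right n p) (ZMod n)) x = ((x.val % n : ℕ) : ZMod n) := by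
  conv_lhs => rw [← ZMod.natCast_zmod_val x]
  rw [map_natCast, ZMod.natCast_mod]

/-- Recombining the digits of `x` gives back `x`. [folklore] -/
theorem digits_combine_digits (x : ZMod (n * p)) :
    ((((ZMod.castHom (dvd_mul_right n p) (ZMod n)) x).val + n * ((x.val / n : ℕ) : ZMod p).val
      : ℕ) : ZMod (n * p)) = x := by
  rw [digits_cast_eq_mod, ZMod.val_cast_of_lt (Nat.mod_lt _ (Nat.pos_of_ne_zero (NeZero.ne n))),
    ZMod.val_cast_of_lt (digits_val_div_lt x)]
  conv_rhs => rw [digits_zmod_eq_mod_add_mul_div x]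
  push_cast; ring

/-- A multiple of `n` vanishes modulo `np` iff its cofactor vanishes modulo `p`. [folklore] -/
theorem digits_natCast_mul_eq_zero_iff (v : ZMod (n * p)) :
    (n : ZMod (n * p)) * v = 0 ↔ (ZMod.castHom (dvd_mul_left p n) (ZMod p)) v = 0 := by
  conv_lhs => rw [← ZMod.natCast_zmod_val v, ← Nat.cast_mul, ZMod.natCast_eq_zero_iff]
  conv_rhs => rw [← ZMod.natCast_zmod_val v, map_natCast, ZMod.natCast_eq_zero_iff]
  exact Nat.mul_dvd_mul_iff_left (Nat.pos_of_ne_zero (NeZero.ne n))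

/-- An element reducing to `0` modulo `n` is `n` times its high digit. [folklore] -/
theorem digits_eq_natCast_mul_of_cast_eq_zero {x : ZMod (n * p)}
    (h : (ZMod.castHom (dvd_mul_right n p) (ZMod n)) x = 0) :
    x = (n : ZMod (n * p)) * ((x.val / n : ℕ) : ZMod (n * p)) := by
  have hmod : x.val % n = 0 := by
    rw [digits_cast_eq_mod, ZMod.natCast_eq_zero_iff] at h
    exact Nat.eq_zero_of_dvd_of_lt h (Nat.mod_lt _ (Nat.pos_of_ne_zero (NeZero.ne n)))
  conv_lhs => rw [digits_zmod_eq_mod_add_mul_div x, hmod]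
  push_cast; ring

omit [NeZero n] [NeZero p] in
/-- `n² = 0` in `ℤ/npℤ` when `p ∣ n`. [folklore] -/
theorem digits_natCast_sq_eq_zero (hpn : p ∣ n) : ((n : ZMod (n * p))) ^ 2 = 0 := by
  rw [sq, ← Nat.cast_mul, ZMod.natCast_eq_zero_iff]
  exact Nat.mul_dvd_mul_left n hpn

omit [NeZero p] in
/-- Reduction modulo `p` of a `val`-lift from `ℤ/nℤ` is reduction modulo `p` (`p ∣ n`). [folklore] -/
theorem digits_cast_natCast_val (hpn : p ∣ n) (y : ZMod n) :
    (ZMod.castHom (dvd_mul_left p n) (ZMod p)) ((y.val : ℕ) : ZMod (n * p))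
      = (ZMod.castHom hpn (ZMod p)) y := by
  rw [map_natCast]
  conv_rhs => rw [← ZMod.natCast_zmod_val y, map_natCast]

omit [NeZero n] in
/-- Reduction modulo `p` of a `val`-lift from `ℤ/pℤ` is the identity. [folklore] -/
theorem digits_cast_natCast_val' (z : ZMod p) :
    (ZMod.castHom (dvd_mul_left p n) (ZMod p)) ((z.val : ℕ) : ZMod (n * p)) = z := by
  rw [map_natCast, ZMod.natCast_zmod_val]

end Digits

/-! ## Forms modulo `np` versus pairs of forms modulo `n` and modulo `p` -/

section Forms

variable {n p : ℕ} [NeZero n] [NeZero p]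

omit [NeZero p] in
/-- Reducing the combined form `y + n·z` modulo `n` recovers `y`. [folklore] -/
theorem digits_map_cast_combine (y : BinaryQuartic (ZMod n)) (z : BinaryQuartic (ZMod p)) :
    (⟨((y.a.val + n * z.a.val : ℕ) : ZMod (n * p)), ((y.b.val + n * z.b.val : ℕ) : ZMod (n * p)),
      ((y.c.val + n * z.c.val : ℕ) : ZMod (n * p)), ((y.d.val + n * z.d.val : ℕ) : ZMod (n * p)),
      ((y.e.val + n * z.e.val : ℕ) : ZMod (n * p))⟩ : BinaryQuartic (ZMod (n * p))).map
        (ZMod.castHom (dvd_mul_right n p) (ZMod n)) = y := by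
  ext <;> simp only [map_a, map_b, map_c, map_d, map_e, digits_cast_combine]

/-- The high digits of the combined form `y + n·z` are `z`. [folklore] -/
theorem digits_hi_combine (y : BinaryQuartic (ZMod n)) (z : BinaryQuartic (ZMod p)) :
    (⟨((((y.a.val + n * z.a.val : ℕ) : ZMod (n * p)).val / n : ℕ) : ZMod p),
      ((((y.b.val + n * z.b.val : ℕ) : ZMod (n * p)).val / n : ℕ) : ZMod p),
      ((((y.c.val + n * z.c.val : ℕ) : ZMod (n * p)).val / n : ℕ) : ZMod p),
      ((((y.d.val + n * z.d.val : ℕ) : ZMod (n * p)).val / n : ℕ) : ZMod p),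
      ((((y.e.val + n * z.e.val : ℕ) : ZMod (n * p)).val / n : ℕ) : ZMod p)⟩ : BinaryQuartic (ZMod p))
      = z := by
  ext <;> simp only [digits_div_combine, ZMod.natCast_zmod_val]

/-- Recombining the low and high digits of a form modulo `np` gives it back. [folklore] -/
theorem digits_combine_digits_form (f : BinaryQuartic (ZMod (n * p))) :
    (⟨((((f.map (ZMod.castHom (dvd_mul_right n p) (ZMod n))).a).val
          + n * (((f.a.val / n : ℕ) : ZMod p)).val : ℕ) : ZMod (n * p)),
      ((((f.map (ZMod.castHom (dvd_mul_right n p) (ZMod n))).b).val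
          + n * (((f.b.val / n : ℕ) : ZMod p)).val : ℕ) : ZMod (n * p)),
      ((((f.map (ZMod.castHom (dvd_mul_right n p) (ZMod n))).c).val
          + n * (((f.c.val / n : ℕ) : ZMod p)).val : ℕ) : ZMod (n * p)),
      ((((f.map (ZMod.castHom (dvd_mul_right n p) (ZMod n))).d).val
          + n * (((f.d.val / n : ℕ) : ZMod p)).val : ℕ) : ZMod (n * p)),
      ((((f.map (ZMod.castHom (dvd_mul_right n p) (ZMod n))).e).val
          + n * (((f.e.val / n : ℕ) : ZMod p)).val : ℕ) : ZMod (n * p))⟩ :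
        BinaryQuartic (ZMod (n * p))) = f := by
  ext <;> simp only [map_a, map_b, map_c, map_d, map_e, digits_combine_digits]

omit [NeZero n] [NeZero p] in
/-- The combined form is `lift(y) + n • lift(z)` with the `val`-lifts. [folklore] -/
theorem digits_combine_eq_lift_add_smul (y : BinaryQuartic (ZMod n)) (z : BinaryQuartic (ZMod p)) :
    (⟨((y.a.val + n * z.a.val : ℕ) : ZMod (n * p)), ((y.b.val + n * z.b.val : ℕ) : ZMod (n * p)),
      ((y.c.val + n * z.c.val : ℕ) : ZMod (n * p)), ((y.d.val + n * z.d.val : ℕ) : ZMod (n * p)),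
      ((y.e.val + n * z.e.val : ℕ) : ZMod (n * p))⟩ : BinaryQuartic (ZMod (n * p)))
      = (⟨(y.a.val : ZMod (n * p)), (y.b.val : ZMod (n * p)), (y.c.val : ZMod (n * p)),
          (y.d.val : ZMod (n * p)), (y.e.val : ZMod (n * p))⟩ : BinaryQuartic (ZMod (n * p)))
        + (n : ZMod (n * p)) • (⟨(z.a.val : ZMod (n * p)), (z.b.val : ZMod (n * p)),
          (z.c.val : ZMod (n * p)), (z.d.val : ZMod (n * p)), (z.e.val : ZMod (n * p))⟩ :
            BinaryQuartic (ZMod (n * p))) := by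
  ext <;> simp only [add_a, add_b, add_c, add_d, add_e, smul_a, smul_b, smul_c, smul_d, smul_e] <;>
    push_cast <;> ring

omit [NeZero p] in
/-- The `val`-lift of `y` reduces to `y` modulo `n`. [folklore] -/
theorem digits_map_cast_lift (y : BinaryQuartic (ZMod n)) :
    (⟨(y.a.val : ZMod (n * p)), (y.b.val : ZMod (n * p)), (y.c.val : ZMod (n * p)),
        (y.d.val : ZMod (n * p)), (y.e.val : ZMod (n * p))⟩ : BinaryQuartic (ZMod (n * p))).map
      (ZMod.castHom (dvd_mul_right n p) (ZMod n)) = y := by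
  ext <;> simp only [map_a, map_b, map_c, map_d, map_e, map_natCast, ZMod.natCast_zmod_val]

omit [NeZero p] in
/-- The `val`-lift of `y` reduces modulo `p` to `y mod p` (`p ∣ n`). [folklore] -/
theorem digits_map_castp_lift (hpn : p ∣ n) (y : BinaryQuartic (ZMod n)) :
    (⟨(y.a.val : ZMod (n * p)), (y.b.val : ZMod (n * p)), (y.c.val : ZMod (n * p)),
        (y.d.val : ZMod (n * p)), (y.e.val : ZMod (n * p))⟩ : BinaryQuartic (ZMod (n * p))).map
      (ZMod.castHom (dvd_mul_left p n) (ZMod p)) = y.map (ZMod.castHom hpn (ZMod p)) := by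
  ext <;> simp only [map_a, map_b, map_c, map_d, map_e, digits_cast_natCast_val hpn]

omit [NeZero n] in
/-- The `val`-lift of `z` reduces to `z` modulo `p`. [folklore] -/
theorem digits_map_castp_lift' (z : BinaryQuartic (ZMod p)) :
    (⟨(z.a.val : ZMod (n * p)), (z.b.val : ZMod (n * p)), (z.c.val : ZMod (n * p)),
        (z.d.val : ZMod (n * p)), (z.e.val : ZMod (n * p))⟩ : BinaryQuartic (ZMod (n * p))).map
      (ZMod.castHom (dvd_mul_left p n) (ZMod p)) = z := by
  ext <;> simp only [map_a, map_b, map_c, map_d, map_e, digits_cast_natCast_val']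

end Forms

/-! ## The polarisations `DI`, `DJ` under ring maps -/

section Polar

variable {R S : Type*} [CommRing R] [CommRing S]

/-- `DI` commutes with ring maps. [folklore] -/
theorem map_DI (φ : R →+* S) (f g : BinaryQuartic R) :
    φ (12 * (f.a * g.e + f.e * g.a) - 3 * (f.b * g.d + f.d * g.b) + 2 * f.c * g.c)
      = 12 * ((f.map φ).a * (g.map φ).e + (f.map φ).e * (g.map φ).a)
        - 3 * ((f.map φ).b * (g.map φ).d + (f.map φ).d * (g.map φ).b)
        + 2 * (f.map φ).c * (g.map φ).c := by
  simp only [map, map_add, map_sub, map_mul, map_ofNat]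

/-- `DJ` commutes with ring maps. [folklore] -/
theorem map_DJ (φ : R →+* S) (f g : BinaryQuartic R) :
    φ ((72 * f.c * f.e - 27 * f.d ^ 2) * g.a + (9 * f.c * f.d - 54 * f.b * f.e) * g.b
        + (72 * f.a * f.e + 9 * f.b * f.d - 6 * f.c ^ 2) * g.c + (9 * f.b * f.c - 54 * f.a * f.d) * g.d
        + (72 * f.a * f.c - 27 * f.b ^ 2) * g.e)
      = (72 * (f.map φ).c * (f.map φ).e - 27 * (f.map φ).d ^ 2) * (g.map φ).a
        + (9 * (f.map φ).c * (f.map φ).d - 54 * (f.map φ).b * (f.map φ).e) * (g.map φ).b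
        + (72 * (f.map φ).a * (f.map φ).e + 9 * (f.map φ).b * (f.map φ).d - 6 * (f.map φ).c ^ 2)
          * (g.map φ).c
        + (9 * (f.map φ).b * (f.map φ).c - 54 * (f.map φ).a * (f.map φ).d) * (g.map φ).d
        + (72 * (f.map φ).a * (f.map φ).c - 27 * (f.map φ).b ^ 2) * (g.map φ).e := by
  simp only [map, map_add, map_sub, map_mul, map_pow, map_ofNat]

end Polar

/-! ## The fibre of reduction modulo `n` over a solution: an affine system over `𝔽_p` -/

section Fibre

variable {n p : ℕ} [NeZero n] [Fact p.Prime]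

/-- **The lifts of a solution modulo `n` that are solutions modulo `np` form an affine system over
`𝔽_p`.** Let `p ∣ n`, `y ∈ V(ℤ/n)` with `I(y) = I₀`, `J(y) = J₀`, and `z ∈ V(𝔽_p)`. Then the combined
form `y + n·z ∈ V(ℤ/np)` has `(I, J) = (I₀, J₀)` iff `DI(ȳ; z) = c_I(y)` and `DJ(ȳ; z) = c_J(y)`,
where `ȳ = y mod p` and the constants are the negatives of the high digits of `I(lift y) − I₀`,
`J(lift y) − J₀` (first-order expansion: `I(ỹ + n z̃) = I(ỹ) + n·DI(ỹ; z̃)` as `n² = 0`).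
[folklore] -/
theorem combine_mem_iff (hpn : p ∣ n) (I₀ J₀ : ℤ) {y : BinaryQuartic (ZMod n)}
    (hyI : y.I = I₀) (hyJ : y.J = J₀) (z : BinaryQuartic (ZMod p)) :
    let f : BinaryQuartic (ZMod (n * p)) :=
      ⟨((y.a.val + n * z.a.val : ℕ) : ZMod (n * p)), ((y.b.val + n * z.b.val : ℕ) : ZMod (n * p)),
        ((y.c.val + n * z.c.val : ℕ) : ZMod (n * p)), ((y.d.val + n * z.d.val : ℕ) : ZMod (n * p)),
        ((y.e.val + n * z.e.val : ℕ) : ZMod (n * p))⟩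
    let yl : BinaryQuartic (ZMod (n * p)) :=
      ⟨(y.a.val : ZMod (n * p)), (y.b.val : ZMod (n * p)), (y.c.val : ZMod (n * p)),
        (y.d.val : ZMod (n * p)), (y.e.val : ZMod (n * p))⟩
    let yb : BinaryQuartic (ZMod p) := y.map (ZMod.castHom hpn (ZMod p))
    (f.I = I₀ ∧ f.J = J₀) ↔
      (12 * (yb.a * z.e + yb.e * z.a) - 3 * (yb.b * z.d + yb.d * z.b) + 2 * yb.c * z.c
          = -((((yl.I - (I₀ : ZMod (n * p))).val / n : ℕ) : ZMod p)) ∧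
       (72 * yb.c * yb.e - 27 * yb.d ^ 2) * z.a + (9 * yb.c * yb.d - 54 * yb.b * yb.e) * z.b
          + (72 * yb.a * yb.e + 9 * yb.b * yb.d - 6 * yb.c ^ 2) * z.c
          + (9 * yb.b * yb.c - 54 * yb.a * yb.d) * z.d + (72 * yb.a * yb.c - 27 * yb.b ^ 2) * z.e
          = -((((yl.J - (J₀ : ZMod (n * p))).val / n : ℕ) : ZMod p))) := by
  intro f yl yb
  haveI : NeZero p := ⟨(Fact.out : p.Prime).ne_zero⟩
  set zl : BinaryQuartic (ZMod (n * p)) :=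
    ⟨(z.a.val : ZMod (n * p)), (z.b.val : ZMod (n * p)), (z.c.val : ZMod (n * p)),
      (z.d.val : ZMod (n * p)), (z.e.val : ZMod (n * p))⟩ with hzl
  have hf : f = yl + (n : ZMod (n * p)) • zl := digits_combine_eq_lift_add_smul y z
  have hn2 : ((n : ZMod (n * p))) ^ 2 = 0 := digits_natCast_sq_eq_zero hpn
  have hn3 : ((n : ZMod (n * p))) ^ 3 = 0 := by rw [pow_succ, hn2, zero_mul]
  -- first-order expansions
  set DI := 12 * (yl.a * zl.e + yl.e * zl.a) - 3 * (yl.b * zl.d + yl.d * zl.b) + 2 * yl.c * zl.c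
    with hDI
  set DJ := (72 * yl.c * yl.e - 27 * yl.d ^ 2) * zl.a + (9 * yl.c * yl.d - 54 * yl.b * yl.e) * zl.b
    + (72 * yl.a * yl.e + 9 * yl.b * yl.d - 6 * yl.c ^ 2) * zl.c + (9 * yl.b * yl.c - 54 * yl.a * yl.d) * zl.d
    + (72 * yl.a * yl.c - 27 * yl.b ^ 2) * zl.e with hDJ
  have hIf : f.I = yl.I + (n : ZMod (n * p)) * DI := by
    rw [hf, I_add_smul, hn2, zero_mul, add_zero]
  have hJf : f.J = yl.J + (n : ZMod (n * p)) * DJ := by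
    rw [hf, J_add_smul, hn2, hn3, zero_mul, zero_mul, add_zero, add_zero]
  -- `I(yl) − I₀` and `J(yl) − J₀` vanish modulo `n`
  have hcastI : (ZMod.castHom (dvd_mul_right n p) (ZMod n)) (yl.I - I₀) = 0 := by
    rw [map_sub, ← I_map, digits_map_cast_lift, ZMod.castHom_apply, ZMod.cast_intCast (dvd_mul_right n p),
      hyI, sub_self]
  have hcastJ : (ZMod.castHom (dvd_mul_right n p) (ZMod n)) (yl.J - J₀) = 0 := by
    rw [map_sub, ← J_map, digits_map_cast_lift, ZMod.castHom_apply, ZMod.cast_intCast (dvd_mul_right n p),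
      hyJ, sub_self]
  have hwI := digits_eq_natCast_mul_of_cast_eq_zero hcastI
  have hwJ := digits_eq_natCast_mul_of_cast_eq_zero hcastJ
  set wI := (((yl.I - (I₀ : ZMod (n * p))).val / n : ℕ) : ZMod (n * p)) with hwIdef
  set wJ := (((yl.J - (J₀ : ZMod (n * p))).val / n : ℕ) : ZMod (n * p)) with hwJdef
  -- reductions modulo `p`
  have hDIp : (ZMod.castHom (dvd_mul_left p n) (ZMod p)) DI
      = 12 * (yb.a * z.e + yb.e * z.a) - 3 * (yb.b * z.d + yb.d * z.b) + 2 * yb.c * z.c := by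
    rw [hDI, map_DI, digits_map_castp_lift hpn, hzl, digits_map_castp_lift']
  have hDJp : (ZMod.castHom (dvd_mul_left p n) (ZMod p)) DJ
      = (72 * yb.c * yb.e - 27 * yb.d ^ 2) * z.a + (9 * yb.c * yb.d - 54 * yb.b * yb.e) * z.b
          + (72 * yb.a * yb.e + 9 * yb.b * yb.d - 6 * yb.c ^ 2) * z.c
          + (9 * yb.b * yb.c - 54 * yb.a * yb.d) * z.d + (72 * yb.a * yb.c - 27 * yb.b ^ 2) * z.e := by
    rw [hDJ, map_DJ, digits_map_castp_lift hpn, hzl, digits_map_castp_lift']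
  have hwIp : (ZMod.castHom (dvd_mul_left p n) (ZMod p)) wI
      = ((((yl.I - (I₀ : ZMod (n * p))).val / n : ℕ) : ZMod p)) := by
    rw [hwIdef, map_natCast]
  have hwJp : (ZMod.castHom (dvd_mul_left p n) (ZMod p)) wJ
      = ((((yl.J - (J₀ : ZMod (n * p))).val / n : ℕ) : ZMod p)) := by
    rw [hwJdef, map_natCast]
  -- `f.I = I₀ ↔ n·(wI + DI) = 0 ↔ …`
  have keyI : f.I = I₀ ↔ 12 * (yb.a * z.e + yb.e * z.a) - 3 * (yb.b * z.d + yb.d * z.b)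
      + 2 * yb.c * z.c = -((((yl.I - (I₀ : ZMod (n * p))).val / n : ℕ) : ZMod p)) := by
    have : f.I = I₀ ↔ (n : ZMod (n * p)) * (wI + DI) = 0 := by
      constructor
      · intro h; linear_combination h - hIf - hwI
      · intro h; linear_combination hIf + hwI + h
    rw [this, digits_natCast_mul_eq_zero_iff, map_add, hDIp, hwIp]
    constructor
    · intro h; linear_combination h
    · intro h; linear_combination h
  have keyJ : f.J = J₀ ↔ (72 * yb.c * yb.e - 27 * yb.d ^ 2) * z.a
      + (9 * yb.c * yb.d - 54 * yb.b * yb.e) * z.b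
      + (72 * yb.a * yb.e + 9 * yb.b * yb.d - 6 * yb.c ^ 2) * z.c
      + (9 * yb.b * yb.c - 54 * yb.a * yb.d) * z.d + (72 * yb.a * yb.c - 27 * yb.b ^ 2) * z.e
        = -((((yl.J - (J₀ : ZMod (n * p))).val / n : ℕ) : ZMod p)) := by
    have : f.J = J₀ ↔ (n : ZMod (n * p)) * (wJ + DJ) = 0 := by
      constructor
      · intro h; linear_combination h - hJf - hwJ
      · intro h; linear_combination hJf + hwJ + h
    rw [this, digits_natCast_mul_eq_zero_iff, map_add, hDJp, hwJp]
    constructor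
    · intro h; linear_combination h
    · intro h; linear_combination h
  exact and_congr keyI keyJ

end Fibre

/-! ## An affine system of rank `2` in five unknowns over `𝔽_p` has `p³` solutions -/

section Linear

variable {F : Type*} [Field F] [Fintype F]

/-- **`p³` solutions.** For `ȳ ∈ V(F)` with `Δ(ȳ) ≠ 0` (`2, 3 ≠ 0` in `F`) and any constants
`c_I, c_J`, the forms `z ∈ V(F)` with `DI(ȳ; z) = c_I`, `DJ(ȳ; z) = c_J` number `(#F)³`: a `2 × 2`
minor of the Jacobian of `(I, J)` at `ȳ` involving the columns `a` and one of `b, c, d` is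
invertible (`jacobianMinor_ne_zero_of_disc_ne_zero`), so two of the unknowns are determined by
the other three. [folklore] -/
theorem natCard_polar_fibre (h2 : (2 : F) ≠ 0) (h3 : (3 : F) ≠ 0) {y : BinaryQuartic F}
    (hΔ : y.disc ≠ 0) (cI cJ : F) :
    Nat.card {z : BinaryQuartic F //
      12 * (y.a * z.e + y.e * z.a) - 3 * (y.b * z.d + y.d * z.b) + 2 * y.c * z.c = cI ∧
      (72 * y.c * y.e - 27 * y.d ^ 2) * z.a + (9 * y.c * y.d - 54 * y.b * y.e) * z.b
        + (72 * y.a * y.e + 9 * y.b * y.d - 6 * y.c ^ 2) * z.c + (9 * y.b * y.c - 54 * y.a * y.d) * z.d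
        + (72 * y.a * y.c - 27 * y.b ^ 2) * z.e = cJ} = Fintype.card F ^ 3 := by
  have hF3 : Nat.card (F × F × F) = Fintype.card F ^ 3 := by
    rw [Nat.card_prod, Nat.card_prod, Nat.card_eq_fintype_card]; ring
  rw [← hF3]
  rcases jacobianMinor_ne_zero_of_disc_ne_zero h2 h3 hΔ with hm | hm | hm
  · -- minor `(a, b)`: solve for `z.a, z.b` in terms of `(z.c, z.d, z.e) = t`
    obtain ⟨m, hmdef⟩ : ∃ m : F, (12 * y.e) * (9 * y.c * y.d - 54 * y.b * y.e) - (-3 * y.d) * (72 * y.c * y.e - 27 * y.d ^ 2) = m := ⟨_, rfl⟩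
    have hm' : m ≠ 0 := by
      rw [← hmdef]; intro h0; apply hm; linear_combination h0
    refine Nat.card_congr
      { toFun := fun z ↦ (z.1.c, z.1.d, z.1.e)
        invFun := fun t ↦ ⟨⟨((9 * y.c * y.d - 54 * y.b * y.e) * (cI - (12 * y.a * t.2.2 - 3 * y.b * t.2.1 + 2 * y.c * t.1)) + 3 * y.d * (cJ - ((72 * y.a * y.e + 9 * y.b * y.d - 6 * y.c ^ 2) * t.1 + (9 * y.b * y.c - 54 * y.a * y.d) * t.2.1 + (72 * y.a * y.c - 27 * y.b ^ 2) * t.2.2))) / m,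
            (12 * y.e * (cJ - ((72 * y.a * y.e + 9 * y.b * y.d - 6 * y.c ^ 2) * t.1 + (9 * y.b * y.c - 54 * y.a * y.d) * t.2.1 + (72 * y.a * y.c - 27 * y.b ^ 2) * t.2.2)) - (72 * y.c * y.e - 27 * y.d ^ 2) * (cI - (12 * y.a * t.2.2 - 3 * y.b * t.2.1 + 2 * y.c * t.1))) / m,
            t.1, t.2.1, t.2.2⟩, ?_, ?_⟩
        left_inv := fun z ↦ ?_
        right_inv := fun t ↦ rfl }
    · dsimp only
      field_simp
      rw [← hmdef]; ring
    · dsimp only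
      field_simp
      rw [← hmdef]; ring
    · obtain ⟨z, hzI, hzJ⟩ := z
      apply Subtype.ext
      ext <;> dsimp only
      · rw [div_eq_iff hm', ← hmdef]
        linear_combination (-(9 * y.c * y.d - 54 * y.b * y.e)) * hzI + (-3 * y.d) * hzJ
      · rw [div_eq_iff hm', ← hmdef]
        linear_combination (72 * y.c * y.e - 27 * y.d ^ 2) * hzI - 12 * y.e * hzJ
  · -- minor `(a, c)`: solve for `z.a, z.c` in terms of `(z.b, z.d, z.e) = t`
    obtain ⟨m, hmdef⟩ : ∃ m : F, (12 * y.e) * (72 * y.a * y.e + 9 * y.b * y.d - 6 * y.c ^ 2) - (2 * y.c) * (72 * y.c * y.e - 27 * y.d ^ 2) = m := ⟨_, rfl⟩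
    have hm' : m ≠ 0 := by
      rw [← hmdef]; intro h0; apply hm; linear_combination h0
    refine Nat.card_congr
      { toFun := fun z ↦ (z.1.b, z.1.d, z.1.e)
        invFun := fun t ↦ ⟨⟨((72 * y.a * y.e + 9 * y.b * y.d - 6 * y.c ^ 2) * (cI - (12 * y.a * t.2.2 - 3 * (y.b * t.2.1 + y.d * t.1))) - 2 * y.c * (cJ - ((9 * y.c * y.d - 54 * y.b * y.e) * t.1 + (9 * y.b * y.c - 54 * y.a * y.d) * t.2.1 + (72 * y.a * y.c - 27 * y.b ^ 2) * t.2.2))) / m,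
            t.1,
            (12 * y.e * (cJ - ((9 * y.c * y.d - 54 * y.b * y.e) * t.1 + (9 * y.b * y.c - 54 * y.a * y.d) * t.2.1 + (72 * y.a * y.c - 27 * y.b ^ 2) * t.2.2)) - (72 * y.c * y.e - 27 * y.d ^ 2) * (cI - (12 * y.a * t.2.2 - 3 * (y.b * t.2.1 + y.d * t.1)))) / m,
            t.2.1, t.2.2⟩, ?_, ?_⟩
        left_inv := fun z ↦ ?_
        right_inv := fun t ↦ rfl }
    · dsimp only
      field_simp
      rw [← hmdef]; ring
    · dsimp only
      field_simp
      rw [← hmdef]; ring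
    · obtain ⟨z, hzI, hzJ⟩ := z
      apply Subtype.ext
      ext <;> dsimp only
      · rw [div_eq_iff hm', ← hmdef]
        linear_combination (-(72 * y.a * y.e + 9 * y.b * y.d - 6 * y.c ^ 2)) * hzI + 2 * y.c * hzJ
      · rw [div_eq_iff hm', ← hmdef]
        linear_combination (72 * y.c * y.e - 27 * y.d ^ 2) * hzI - 12 * y.e * hzJ
  · -- minor `(a, d)`: solve for `z.a, z.d` in terms of `(z.b, z.c, z.e) = t`
    obtain ⟨m, hmdef⟩ : ∃ m : F, (12 * y.e) * (9 * y.b * y.c - 54 * y.a * y.d) - (-3 * y.b) * (72 * y.c * y.e - 27 * y.d ^ 2) = m := ⟨_, rfl⟩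
    have hm' : m ≠ 0 := by
      rw [← hmdef]; intro h0; apply hm; linear_combination h0
    refine Nat.card_congr
      { toFun := fun z ↦ (z.1.b, z.1.c, z.1.e)
        invFun := fun t ↦ ⟨⟨((9 * y.b * y.c - 54 * y.a * y.d) * (cI - (12 * y.a * t.2.2 - 3 * y.d * t.1 + 2 * y.c * t.2.1)) + 3 * y.b * (cJ - ((9 * y.c * y.d - 54 * y.b * y.e) * t.1 + (72 * y.a * y.e + 9 * y.b * y.d - 6 * y.c ^ 2) * t.2.1 + (72 * y.a * y.c - 27 * y.b ^ 2) * t.2.2))) / m,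
            t.1, t.2.1,
            (12 * y.e * (cJ - ((9 * y.c * y.d - 54 * y.b * y.e) * t.1 + (72 * y.a * y.e + 9 * y.b * y.d - 6 * y.c ^ 2) * t.2.1 + (72 * y.a * y.c - 27 * y.b ^ 2) * t.2.2)) - (72 * y.c * y.e - 27 * y.d ^ 2) * (cI - (12 * y.a * t.2.2 - 3 * y.d * t.1 + 2 * y.c * t.2.1))) / m,
            t.2.2⟩, ?_, ?_⟩
        left_inv := fun z ↦ ?_
        right_inv := fun t ↦ rfl }
    · dsimp only
      field_simp
      rw [← hmdef]; ring
    · dsimp only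
      field_simp
      rw [← hmdef]; ring
    · obtain ⟨z, hzI, hzJ⟩ := z
      apply Subtype.ext
      ext <;> dsimp only
      · rw [div_eq_iff hm', ← hmdef]
        linear_combination (-(9 * y.b * y.c - 54 * y.a * y.d)) * hzI + (-3 * y.b) * hzJ
      · rw [div_eq_iff hm', ← hmdef]
        linear_combination (72 * y.c * y.e - 27 * y.d ^ 2) * hzI - 12 * y.e * hzJ

end Linear

/-! ## The count modulo `np` from the count modulo `n`, and modulo prime powers -/

section Step

variable {n p : ℕ} [NeZero n] [Fact p.Prime]

/-- **Hensel step: `#{f ∈ V(ℤ/np) : (I,J) = (I₀,J₀)} = p³ · #{f ∈ V(ℤ/n) : (I,J) = (I₀,J₀)}`** for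
`p ∣ n`, `p ≥ 5`, `p ∤ 4I₀³ − J₀²`: every solution modulo `n` has exactly `p³` lifts (the fibre is
a rank-`2` affine system over `𝔽_p`, `natCard_polar_fibre`). [folklore] -/
theorem natCard_invariants_mul (hp : 5 ≤ p) (hpn : p ∣ n) (I₀ J₀ : ℤ)
    (hIJ : ¬ (p : ℤ) ∣ 4 * I₀ ^ 3 - J₀ ^ 2) :
    Nat.card {f : BinaryQuartic (ZMod (n * p)) // f.I = I₀ ∧ f.J = J₀} =
      Nat.card {y : BinaryQuartic (ZMod n) // y.I = I₀ ∧ y.J = J₀} * p ^ 3 := by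
  haveI : NeZero p := ⟨(Fact.out : p.Prime).ne_zero⟩
  obtain ⟨h2, h3⟩ := two_three_ne_zero_zmod hp
  -- the projection to solutions modulo `n`
  set π : {f : BinaryQuartic (ZMod (n * p)) // f.I = I₀ ∧ f.J = J₀} →
      {y : BinaryQuartic (ZMod n) // y.I = I₀ ∧ y.J = J₀} := fun f ↦
    ⟨f.1.map (ZMod.castHom (dvd_mul_right n p) (ZMod n)), by
      rw [I_map, J_map, f.2.1, f.2.2, ZMod.castHom_apply, ZMod.castHom_apply,
        ZMod.cast_intCast (dvd_mul_right n p), ZMod.cast_intCast (dvd_mul_right n p)]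
      exact ⟨rfl, rfl⟩⟩ with hπ
  rw [← Nat.card_congr (Equiv.sigmaFiberEquiv π), Nat.card_sigma]
  -- every fibre has `p³` elements
  have hfib : ∀ y : {y : BinaryQuartic (ZMod n) // y.I = I₀ ∧ y.J = J₀},
      Nat.card {f // π f = y} = p ^ 3 := by
    intro y
    -- the reduction of `y` modulo `p` has nonzero discriminant
    set yb := y.1.map (ZMod.castHom hpn (ZMod p)) with hyb
    have hybΔ : yb.disc ≠ 0 := by
      intro h0
      apply hIJ
      rw [← ZMod.intCast_zmod_eq_zero_iff_dvd]
      have h27 := twentySeven_mul_disc yb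
      rw [h0, mul_zero, hyb, I_map, J_map, y.2.1, y.2.2, ZMod.castHom_apply, ZMod.castHom_apply,
        ZMod.cast_intCast hpn, ZMod.cast_intCast hpn] at h27
      push_cast
      exact h27.symm
    have hcount := natCard_polar_fibre h2 h3 hybΔ
      (-((((⟨(y.1.a.val : ZMod (n * p)), (y.1.b.val : ZMod (n * p)), (y.1.c.val : ZMod (n * p)),
          (y.1.d.val : ZMod (n * p)), (y.1.e.val : ZMod (n * p))⟩ : BinaryQuartic (ZMod (n * p))).I
          - (I₀ : ZMod (n * p))).val / n : ℕ) : ZMod p))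
      (-((((⟨(y.1.a.val : ZMod (n * p)), (y.1.b.val : ZMod (n * p)), (y.1.c.val : ZMod (n * p)),
          (y.1.d.val : ZMod (n * p)), (y.1.e.val : ZMod (n * p))⟩ : BinaryQuartic (ZMod (n * p))).J
          - (J₀ : ZMod (n * p))).val / n : ℕ) : ZMod p))
    rw [ZMod.card] at hcount
    rw [← hcount]
    refine Nat.card_congr
      { toFun := fun f ↦ ⟨⟨((f.1.1.a.val / n : ℕ) : ZMod p), ((f.1.1.b.val / n : ℕ) : ZMod p),
            ((f.1.1.c.val / n : ℕ) : ZMod p), ((f.1.1.d.val / n : ℕ) : ZMod p),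
            ((f.1.1.e.val / n : ℕ) : ZMod p)⟩, by
          obtain ⟨⟨f, hfP⟩, hπf⟩ := f
          subst hπf
          exact (combine_mem_iff hpn I₀ J₀ (π ⟨f, hfP⟩).2.1 (π ⟨f, hfP⟩).2.2 _).mp
            (by rw [hπ]; dsimp only; rw [digits_combine_digits_form f]; exact hfP)⟩
        invFun := fun z ↦ ⟨⟨⟨((y.1.a.val + n * z.1.a.val : ℕ) : ZMod (n * p)),
            ((y.1.b.val + n * z.1.b.val : ℕ) : ZMod (n * p)),
            ((y.1.c.val + n * z.1.c.val : ℕ) : ZMod (n * p)),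
            ((y.1.d.val + n * z.1.d.val : ℕ) : ZMod (n * p)),
            ((y.1.e.val + n * z.1.e.val : ℕ) : ZMod (n * p))⟩,
            (combine_mem_iff hpn I₀ J₀ y.2.1 y.2.2 z.1).mpr z.2⟩,
          Subtype.ext (digits_map_cast_combine y.1 z.1)⟩
        left_inv := fun f ↦ by
          obtain ⟨⟨f, hfP⟩, hπf⟩ := f
          subst hπf
          apply Subtype.ext; apply Subtype.ext
          exact digits_combine_digits_form f
        right_inv := fun z ↦ Subtype.ext (digits_hi_combine y.1 z.1) }
  rw [Finset.sum_congr rfl fun y _ ↦ hfib y, Finset.sum_const, Finset.card_univ, smul_eq_mul,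
    Nat.card_eq_fintype_card]

end Step

section PrimePower

variable {p : ℕ} [Fact p.Prime]

/-- **Forms with prescribed nondegenerate invariants modulo `pᵏ`.** For a prime `p ≥ 5`, integers
`I₀, J₀` with `p ∤ 4I₀³ − J₀²`, and `k ≥ 1`:
`#{f ∈ V(ℤ/pᵏℤ) : I(f) ≡ I₀, J(f) ≡ J₀} = (p³ − p)·p^{3(k−1)}` (`= #PGL₂(ℤ/pᵏℤ)`). Equivalently the
`p`-adic measure of `{f ∈ V_{ℤ_p} : (I(f), J(f)) ∈ (I₀, J₀) + pᵏℤ_p²}` is `(1 − p⁻²)·p^{−2k}`: over the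
locus `p ∤ 4I³ − J²` the invariant map pushes `μ_p` forward to `(1 − p⁻²)·dI dJ` — the good-reduction
case of the `p`-adic change-of-measure formula behind Bhargava–Shankar's local masses (Prop. 5.12 of
the arXiv v2 text; Props. 3.7–3.9 of the published version: the factor `Vol(PGL₂(ℤ_p)) = 1 − p⁻²`).
[cite: BhargavaShankarAnnals2015, Prop. 5.12 (arXiv:1006.1002v2 numbering)] -/
theorem natCard_invariants_zmod_primePow (hp : 5 ≤ p) (I₀ J₀ : ℤ)
    (hIJ : ¬ (p : ℤ) ∣ 4 * I₀ ^ 3 - J₀ ^ 2) {k : ℕ} (hk : 1 ≤ k) :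
    Nat.card {f : BinaryQuartic (ZMod (p ^ k)) // f.I = I₀ ∧ f.J = J₀} =
      (p ^ 3 - p) * p ^ (3 * (k - 1)) := by
  haveI : NeZero p := ⟨(Fact.out : p.Prime).ne_zero⟩
  obtain ⟨h2, h3⟩ := two_three_ne_zero_zmod hp
  induction k, hk using Nat.le_induction with
  | base =>
    -- `ℤ/p¹ = 𝔽_p`: the count of `BinaryQuarticInvariantCountProofs`
    rw [Nat.sub_self, mul_zero, pow_zero, mul_one]
    set e : ZMod (p ^ 1) ≃+* ZMod p := ZMod.ringEquivCongr (pow_one p) with he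
    have hIJp : 4 * ((I₀ : ZMod p)) ^ 3 - ((J₀ : ZMod p)) ^ 2 ≠ 0 := by
      intro h0
      apply hIJ
      rw [← ZMod.intCast_zmod_eq_zero_iff_dvd]
      push_cast
      exact h0
    rw [← ZMod.card p, ← natCard_invariants_eq h2 h3 hIJp, ZMod.card p]
    refine Nat.card_congr
      { toFun := fun f ↦ ⟨f.1.map e.toRingHom, by
          rw [I_map, J_map, f.2.1, f.2.2]; simp⟩
        invFun := fun g ↦ ⟨g.1.map e.symm.toRingHom, by
          rw [I_map, J_map, g.2.1, g.2.2]; simp⟩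
        left_inv := fun f ↦ by
          apply Subtype.ext
          ext <;> simp [map]
        right_inv := fun g ↦ by
          apply Subtype.ext
          ext <;> simp [map] }
  | succ k hk ih =>
    rw [show p ^ (k + 1) = p ^ k * p from pow_succ p k] at *
    rw [natCard_invariants_mul hp (dvd_pow_self p (by omega)) I₀ J₀ hIJ, ih]
    rw [show k + 1 - 1 = (k - 1) + 1 by omega, Nat.mul_add, pow_add]
    ring

end PrimePower

end BinaryQuartic

end Literature.NumberTheory.EllipticCurves

end
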